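import Summits.QuantumFields.BalabanUV.T4Continuum.Support.NE3CurlStability

/-!
# T⁴ programme, node NE3, route P2 «ENERGY CONVEXITY» — sub-row S5-Y8a part 1d: CURL-REFINED SMALL-FIELD STABILITY
# ALONG THE EXPONENTIAL SEGMENT (the moving plaquette radius to first order in the dressed curl)

NE3 formalisation swarm `b2b-balaban-t4-ne3-formalise-*`, unit `b2b-balaban-t4-ne3-formalise-leaf-03` (gen 4), sub-row
**S5-Y8a-1d** of `t4/formal/NE3/LEAVES.md` (journal INTENT 2026-08-20T11:05Z; family S5-Y8a: `NE3EnergyHessBilin` p214531,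
`NE3EnergyHessCont` p214575, `NE3EnergyHessTwoTerm` p215847, `NE3EnergyHessContTwoTerm` p216070).

WHY.  The weighted display of part 1c (`NE3EnergyHessContTwoTerm.abs_hessSym_perWin_vary_le_weighted`) has a k-FREE constant
in a down-weighted currency `√(curlSq + dirSq∕s²)`, `s = L^k`, exactly when `δ·L^k` and `a′·L^{2k}` stay bounded, `a′` being
the PLAQUETTE RADIUS OF THE MOVING CONFIGURATION `W·e^{tX}`.  The tree's `NE3EnergyVary.smallField_vary` (road P2) bounds
`a′ ≤ a + 4(e^{sup‖X‖} − 1)`, i.e. `O(L^{−k})` for chart data — one power short.  The first-order term of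
`(W e^{tX})(∂p′) − W(∂p′)` is the DRESSED CURL (`T4AveragingDeficitWall.hasDerivAt_hol_vary`:
`d∕ds|₀ (W e^{sX})(∂p′) = (d_W X)(p′)·W(∂p′)`), which for chart data is `O(L^{−2k})`.  THIS FILE ([folklore] calculus,
0 `def`, 0 sorry):
* `hasDerivAt_hol_vary_at` — the derivative at EVERY `s`: `d∕ds (W e^{sX})(∂p′) = (d_{W e^{sX}} X)(p′)·(W e^{sX})(∂p′)`
  (the tree's `s = 0` statement shifted by `NE3HessForm.vary_add`);
* **`norm_hol_vary_sub_hol_le_curl`** — for unitary `W`, skew `X` with `‖X(b)‖ ≤ α` and `0 ≤ t`: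
  `‖(W e^{tX})(∂p′) − W(∂p′)‖ ≤ t·(‖(d_W X)(p′)‖ + 6(e^{tα} − 1)·bondL1At X p′)`
  (mean-value inequality; unitary words have norm `≤ 1`; P3's `NE3CurlStability.norm_curlAt_vary_sub_le` with `Y := X`);
* **`norm_hol_vary_sub_one_le_curl`** ∕ **`smallField_vary_curl`** — the moving plaquette radius:
  `‖(W e^{tX})(∂p′) − 1‖ ≤ ‖W(∂p′) − 1‖ + t(‖(d_W X)(p′)‖ + 24α(e^{tα} − 1))` and
  `SmallField W a → (∀ p′, ‖(d_W X)(p′)‖ ≤ γ) → SmallField (W e^{tX}) (a + t(γ + 24α(e^{tα} − 1)))` for `t ∈ [0,1]`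
  (`bondL1At ≤ 4α`) — the hypothesis `ha` of part 1c and the `SmallField (vary V X t) a′` hypothesis of
  `NE3HessBounds.hess_self_ge` ∕ `NE3CurlStability.hess_self_ge_vary`, with ONE MORE POWER of the lattice spacing than
  `smallField_vary`: reading `α = c₀∕L^k`, `γ = c₁∕L^{2k}` (chart data), `a = b∕L^{2k}`:
  `a′·L^{2k} ≤ b + c₁ + 24c₀·(e^{c₀∕L^k} − 1)·L^k ≤ b + c₁ + 24c₀²e^{c₀}` — k-FREE (docstring arithmetic only).

HONEST FRAMING.  Finite-T⁴ bookkeeping (rung (B)+1); first-order calculus on one configuration along one segment; NOTHING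
about Bałaban's minimisers; no coercivity, no norm choice (LEAVES ρ19 clean); no conditional of the cell (`BetaPertH`, (B),
G-an2-4) used or hidden; NOT infinite volume ∕ mass gap ∕ Clay ∕ summit progress; **NE3 is NOT proved**; spine PROVED 0∕9.
ABSOLUTE RULE kept (no printed sentence is a hypothesis; context [Balaban1985Variational] (19)–(21) p. 281, (43) p. 285).
PLACEMENT: `Summits/QuantumFields/BalabanUV/`; imports road P3's `Support.NE3CurlStability` (p214150) BY NAME (which carries
`NE3HessForm.vary_add`, `AveragingDeficitTransport.mem_U1_of_unitary`); restates nothing, moves nothing.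
-/

set_option autoImplicit false

open scoped BigOperators Matrix.Norms.L2Operator
open NormedSpace Finset Set

namespace Summit.QuantumFields.BalabanUV.T4Continuum.NE3EnergySmallFieldCurl

open Literature.MathematicalPhysics.QuantumFieldTheory.Balaban1983to89
open B7Prop1Explicit B7Prop2Explicit MatrixLog UnitaryModel
open T4AveragingDeficitWall hiding Site Plane Plaq Bond
open AveragingDeficitTransport (mem_U1_of_unitary)
open AveragingDeficitPlaqDeriv (vary_isUnitaryCfg)
open NE3HessForm (vary_add)
open NE3HessContinuity (bondL1At bondL1At_nonneg)
open NE3CurlStability (norm_curlAt_vary_sub_le)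

noncomputable section

variable {d : ℕ} {n : Type*} [Fintype n] [DecidableEq n]

/-! ## §1 The derivative of the plaquette variable at every parameter -/

/-- **`d∕ds (W e^{sX})(∂p′) = (d_{W e^{sX}} X)(p′) · (W e^{sX})(∂p′)` AT EVERY `s`** (the tree's
`hasDerivAt_hol_vary` is the case `s = 0`; shift by `vary_add : vary W X (s + r) = vary (vary W X s) X r`). [folklore] -/
theorem hasDerivAt_hol_vary_at (W : Site d → Fin d → (Matrix n n ℂ)ˣ) (X : Site d → Fin d → Matrix n n ℂ)
    (z : Site d) (μ ν : Fin d) (s : ℝ) :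
    HasDerivAt (fun r : ℝ => ((hol (vary W X r) z (plaqWord μ ν) : (Matrix n n ℂ)ˣ) : Matrix n n ℂ))
      (curlAt (vary W X s) X z μ ν * ((hol (vary W X s) z (plaqWord μ ν) : (Matrix n n ℂ)ˣ) : Matrix n n ℂ)) s := by
  have h0 := hasDerivAt_hol_vary (vary W X s) X z μ ν
  -- shift the base point: `r ↦ s + r`
  have h1 : HasDerivAt (fun r : ℝ => ((hol (vary (vary W X s) X (r - s)) z (plaqWord μ ν) : (Matrix n n ℂ)ˣ) :
      Matrix n n ℂ)) (curlAt (vary W X s) X z μ ν * ((hol (vary W X s) z (plaqWord μ ν) : (Matrix n n ℂ)ˣ) :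
        Matrix n n ℂ)) s := by
    have h := HasDerivAt.comp_sub_const (f := fun r : ℝ => ((hol (vary (vary W X s) X r) z (plaqWord μ ν) :
      (Matrix n n ℂ)ˣ) : Matrix n n ℂ)) s s (by rw [sub_self]; exact h0)
    simpa [vary_zero] using h
  refine h1.congr_of_eventuallyEq (Filter.Eventually.of_forall fun r => ?_)
  show ((hol (vary W X r) z (plaqWord μ ν) : (Matrix n n ℂ)ˣ) : Matrix n n ℂ)
      = ((hol (vary (vary W X s) X (r - s)) z (plaqWord μ ν) : (Matrix n n ℂ)ˣ) : Matrix n n ℂ)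
  rw [← vary_add, add_sub_cancel]

/-! ## §2 The perturbed plaquette variable to first order in the dressed curl -/

/-- **`‖(W e^{tX})(∂p′) − W(∂p′)‖ ≤ t·(‖(d_W X)(p′)‖ + 6(e^{tα} − 1)·bondL1At X p′)`** for unitary `W`, skew `X` with
`‖X(b)‖ ≤ α`, `0 ≤ t` (mean value along the segment; the moving dressed curl controlled by P3's first-order stability).
[folklore] -/
theorem norm_hol_vary_sub_hol_le_curl [Nonempty n] {W : Site d → Fin d → (Matrix n n ℂ)ˣ} (hW : IsUnitaryCfg W)
    {X : Site d → Fin d → Matrix n n ℂ} (hX : IsSkewDir X) {α : ℝ} (hXα : ∀ x κ, ‖X x κ‖ ≤ α) {t : ℝ} (ht : 0 ≤ t)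
    (z : Site d) (μ ν : Fin d) :
    ‖((hol (vary W X t) z (plaqWord μ ν) : (Matrix n n ℂ)ˣ) : Matrix n n ℂ)
        - ((hol W z (plaqWord μ ν) : (Matrix n n ℂ)ˣ) : Matrix n n ℂ)‖
      ≤ t * (‖curlAt W X z μ ν‖ + 6 * (Real.exp (t * α) - 1) * bondL1At X z μ ν) := by
  set f : ℝ → Matrix n n ℂ := fun r => ((hol (vary W X r) z (plaqWord μ ν) : (Matrix n n ℂ)ˣ) : Matrix n n ℂ)
    with hf
  set C := ‖curlAt W X z μ ν‖ + 6 * (Real.exp (t * α) - 1) * bondL1At X z μ ν with hC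
  -- derivative at every point of [0,t]
  have hderiv : ∀ s ∈ Icc (0 : ℝ) t, HasDerivWithinAt f
      (curlAt (vary W X s) X z μ ν * ((hol (vary W X s) z (plaqWord μ ν) : (Matrix n n ℂ)ˣ) : Matrix n n ℂ))
      (Icc (0 : ℝ) t) s :=
    fun s _ => (hasDerivAt_hol_vary_at W X z μ ν s).hasDerivWithinAt
  -- bound on the derivative on [0,t)
  have hα0 : 0 ≤ α := (norm_nonneg _).trans (hXα z μ)
  have hbound : ∀ s ∈ Ico (0 : ℝ) t,
      ‖curlAt (vary W X s) X z μ ν * ((hol (vary W X s) z (plaqWord μ ν) : (Matrix n n ℂ)ˣ) : Matrix n n ℂ)‖ ≤ C := by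
    intro s hs
    have hs0 : 0 ≤ s := hs.1
    have hst : s ≤ t := hs.2.le
    -- the word is unitary: norm ≤ 1
    have hU : ∀ y κ, vary W X s y κ ∈ U1 (Matrix n n ℂ) := fun y κ => mem_U1_of_unitary (vary_isUnitaryCfg hW hX s y κ)
    have hhol : ‖((hol (vary W X s) z (plaqWord μ ν) : (Matrix n n ℂ)ˣ) : Matrix n n ℂ)‖ ≤ 1 :=
      (mem_U1.mp (hol_mem hU z (plaqWord μ ν))).1
    -- the moving curl against the fixed one
    have hcurl := norm_curlAt_vary_sub_le hW hX hXα s X z μ ν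
    rw [abs_of_nonneg hs0] at hcurl
    have hexp : Real.exp (s * α) - 1 ≤ Real.exp (t * α) - 1 := by
      have := Real.exp_le_exp.mpr (mul_le_mul_of_nonneg_right hst hα0)
      linarith
    have hB0 : 0 ≤ bondL1At X z μ ν := bondL1At_nonneg _ _ _ _
    have hc1 : ‖curlAt (vary W X s) X z μ ν‖ ≤ C := by
      calc ‖curlAt (vary W X s) X z μ ν‖
          = ‖curlAt W X z μ ν + (curlAt (vary W X s) X z μ ν - curlAt W X z μ ν)‖ := by rw [add_sub_cancel]
        _ ≤ ‖curlAt W X z μ ν‖ + ‖curlAt (vary W X s) X z μ ν - curlAt W X z μ ν‖ := norm_add_le _ _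
        _ ≤ ‖curlAt W X z μ ν‖ + 6 * (Real.exp (s * α) - 1) * bondL1At X z μ ν := by linarith
        _ ≤ C := by
            rw [hC]
            have := mul_le_mul_of_nonneg_right (mul_le_mul_of_nonneg_left hexp (by norm_num : (0:ℝ) ≤ 6)) hB0
            linarith
    have hC0 : 0 ≤ C := (norm_nonneg _).trans hc1
    calc ‖curlAt (vary W X s) X z μ ν * ((hol (vary W X s) z (plaqWord μ ν) : (Matrix n n ℂ)ˣ) : Matrix n n ℂ)‖
        ≤ ‖curlAt (vary W X s) X z μ ν‖ * ‖((hol (vary W X s) z (plaqWord μ ν) : (Matrix n n ℂ)ˣ) : Matrix n n ℂ)‖ :=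
          norm_mul_le _ _
      _ ≤ C * 1 := mul_le_mul hc1 hhol (norm_nonneg _) hC0
      _ = C := mul_one C
  have hmv := norm_image_sub_le_of_norm_deriv_le_segment' hderiv hbound t (right_mem_Icc.mpr ht)
  have e0 : f 0 = ((hol W z (plaqWord μ ν) : (Matrix n n ℂ)ˣ) : Matrix n n ℂ) := by rw [hf]; simp only [vary_zero]
  rw [e0, sub_zero] at hmv
  rw [mul_comm]
  exact hmv

/-- **THE MOVING PLAQUETTE RADIUS TO FIRST ORDER IN THE CURL**: for unitary `W`, skew `X` with `‖X(b)‖ ≤ α` and `0 ≤ t`,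
`‖(W e^{tX})(∂p′) − 1‖ ≤ ‖W(∂p′) − 1‖ + t·(‖(d_W X)(p′)‖ + 24α(e^{tα} − 1))` (`bondL1At X p′ ≤ 4α`). [folklore] -/
theorem norm_hol_vary_sub_one_le_curl [Nonempty n] {W : Site d → Fin d → (Matrix n n ℂ)ˣ} (hW : IsUnitaryCfg W)
    {X : Site d → Fin d → Matrix n n ℂ} (hX : IsSkewDir X) {α : ℝ} (hXα : ∀ x κ, ‖X x κ‖ ≤ α) {t : ℝ} (ht : 0 ≤ t)
    (z : Site d) (μ ν : Fin d) :
    ‖((hol (vary W X t) z (plaqWord μ ν) : (Matrix n n ℂ)ˣ) : Matrix n n ℂ) - 1‖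
      ≤ ‖((hol W z (plaqWord μ ν) : (Matrix n n ℂ)ˣ) : Matrix n n ℂ) - 1‖
        + t * (‖curlAt W X z μ ν‖ + 24 * α * (Real.exp (t * α) - 1)) := by
  have h := norm_hol_vary_sub_hol_le_curl hW hX hXα ht z μ ν
  set Ht := ((hol (vary W X t) z (plaqWord μ ν) : (Matrix n n ℂ)ˣ) : Matrix n n ℂ)
  set H0 := ((hol W z (plaqWord μ ν) : (Matrix n n ℂ)ˣ) : Matrix n n ℂ)
  have hα0 : 0 ≤ α := (norm_nonneg _).trans (hXα z μ)
  have hB : bondL1At X z μ ν ≤ 4 * α := by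
    unfold bondL1At
    linarith [hXα z μ, hXα (z + e μ) ν, hXα (z + e ν) μ, hXα z ν]
  have hexp : 0 ≤ Real.exp (t * α) - 1 := by
    have := Real.one_le_exp (mul_nonneg ht hα0)
    linarith
  have h6 : 6 * (Real.exp (t * α) - 1) * bondL1At X z μ ν ≤ 24 * α * (Real.exp (t * α) - 1) := by
    have := mul_le_mul_of_nonneg_left hB (by positivity : (0:ℝ) ≤ 6 * (Real.exp (t * α) - 1))
    linarith
  have h' : ‖Ht - H0‖ ≤ t * (‖curlAt W X z μ ν‖ + 24 * α * (Real.exp (t * α) - 1)) :=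
    h.trans (mul_le_mul_of_nonneg_left (by linarith) ht)
  calc ‖Ht - 1‖ = ‖(H0 - 1) + (Ht - H0)‖ := by congr 1; abel
    _ ≤ ‖H0 - 1‖ + ‖Ht - H0‖ := norm_add_le _ _
    _ ≤ ‖H0 - 1‖ + t * (‖curlAt W X z μ ν‖ + 24 * α * (Real.exp (t * α) - 1)) := by linarith

/-- **CURL-REFINED SMALL-FIELD STABILITY** (the `SmallField` predicate): for unitary `W` with `SmallField W a`, skew `X`
with `‖X(b)‖ ≤ α` and a UNIFORM DRESSED-CURL BOUND `‖(d_W X)(p′)‖ ≤ γ`, and `t ∈ [0,1]`: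
`SmallField (W e^{tX}) (a + t·(γ + 24α(e^{tα} − 1)))`.  Reading for chart data (`a = b∕L^{2k}`, `α = c₀∕L^k`,
`γ = c₁∕L^{2k}`): the moving radius times `L^{2k}` is `≤ b + c₁ + 24c₀²e^{c₀}`, k-FREE — the input that makes part 1c's
weighted continuity constant k-uniform (docstring arithmetic; nothing about minimisers). [folklore] -/
theorem smallField_vary_curl [Nonempty n] {W : Site d → Fin d → (Matrix n n ℂ)ˣ} (hW : IsUnitaryCfg W)
    {X : Site d → Fin d → Matrix n n ℂ} (hX : IsSkewDir X) {α γ a : ℝ} (hXα : ∀ x κ, ‖X x κ‖ ≤ α)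
    (hγ : ∀ (z : Site d) (μ ν : Fin d), μ ≠ ν → ‖curlAt W X z μ ν‖ ≤ γ) (ha : SmallField W a) {t : ℝ} (ht : 0 ≤ t) :
    SmallField (vary W X t) (a + t * (γ + 24 * α * (Real.exp (t * α) - 1))) := by
  intro z μ ν hμν
  have h := norm_hol_vary_sub_one_le_curl hW hX hXα ht z μ ν
  have h1 := ha z μ ν hμν
  have h2 := hγ z μ ν hμν
  have h3 : t * (‖curlAt W X z μ ν‖ + 24 * α * (Real.exp (t * α) - 1)) ≤ t * (γ + 24 * α * (Real.exp (t * α) - 1)) :=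
    mul_le_mul_of_nonneg_left (by linarith) ht
  linarith

/-- **THE SAME WITH A POLYNOMIAL CONSTANT** (the typer's requested TYPE `a_t ≤ a + t·(curl sup) + C·t²·(bond sup)²`,
`C = 24·e^{tα}` displayed): `SmallField (W e^{tX}) (a + t·γ + 24·e^{tα}·t²·α²)` for `t ≥ 0`. [folklore] -/
theorem smallField_vary_curl' [Nonempty n] {W : Site d → Fin d → (Matrix n n ℂ)ˣ} (hW : IsUnitaryCfg W)
    {X : Site d → Fin d → Matrix n n ℂ} (hX : IsSkewDir X) {α γ a : ℝ} (hXα : ∀ x κ, ‖X x κ‖ ≤ α)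
    (hγ : ∀ (z : Site d) (μ ν : Fin d), μ ≠ ν → ‖curlAt W X z μ ν‖ ≤ γ) (ha : SmallField W a) {t : ℝ} (ht : 0 ≤ t) :
    SmallField (vary W X t) (a + t * γ + 24 * Real.exp (t * α) * t ^ 2 * α ^ 2) := by
  intro z μ ν hμν
  have h := smallField_vary_curl hW hX hXα hγ ha ht z μ ν hμν
  have hα0 : 0 ≤ α := (norm_nonneg _).trans (hXα z μ)
  -- `e^x − 1 ≤ x e^x` (tree: `Literature…AreaLaw.exp_sub_one_le_mul_exp`; re-derived inline to keep the import cone small)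
  have he : Real.exp (t * α) - 1 ≤ (t * α) * Real.exp (t * α) := by
    have h1 : (1 - t * α) * Real.exp (t * α) ≤ 1 := by
      calc (1 - t * α) * Real.exp (t * α) ≤ Real.exp (-(t * α)) * Real.exp (t * α) := by
            gcongr; linarith [Real.add_one_le_exp (-(t * α))]
        _ = 1 := by rw [← Real.exp_add, neg_add_cancel, Real.exp_zero]
    nlinarith [h1, Real.exp_pos (t * α)]
  have h24 : 24 * α * (Real.exp (t * α) - 1) ≤ 24 * α * ((t * α) * Real.exp (t * α)) :=
    mul_le_mul_of_nonneg_left he (by positivity)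
  have h3 : t * (γ + 24 * α * (Real.exp (t * α) - 1)) ≤ t * γ + 24 * Real.exp (t * α) * t ^ 2 * α ^ 2 := by
    have := mul_le_mul_of_nonneg_left (add_le_add_left h24 γ) ht
    nlinarith
  linarith

/-- The same on a plaquette WINDOW, in the `fhol`-form the consumers use (`ha` of
`NE3EnergyHessContTwoTerm.abs_hessSym_perWin_vary_le_twoTerm`, `NE3EnergyHessTwoTerm.abs_hessSym_perWin_le_twoTerm`):
pointwise radii `‖W(∂p) − 1‖ ≤ a` and curl bounds `‖(d_W X)(p)‖ ≤ γ` on `Wn` give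
`‖(W e^{tX})(∂p) − 1‖ ≤ a + t(γ + 24α(e^{tα} − 1))` on `Wn`. [folklore] -/
theorem norm_fhol_vary_sub_one_le_curl [Nonempty n] {W : Site d → Fin d → (Matrix n n ℂ)ˣ} (hW : IsUnitaryCfg W)
    {X : Site d → Fin d → Matrix n n ℂ} (hX : IsSkewDir X) {α γ a : ℝ} (hXα : ∀ x κ, ‖X x κ‖ ≤ α)
    (Wn : Finset (T4AveragingDeficitWall.Plaq d))
    (hγ : ∀ p ∈ Wn, ‖curl W X p‖ ≤ γ)
    (ha : ∀ p ∈ Wn, ‖((fhol W p : (Matrix n n ℂ)ˣ) : Matrix n n ℂ) - 1‖ ≤ a) {t : ℝ} (ht : 0 ≤ t) :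
    ∀ p ∈ Wn, ‖((fhol (vary W X t) p : (Matrix n n ℂ)ˣ) : Matrix n n ℂ) - 1‖ ≤ a + t * (γ + 24 * α * (Real.exp (t * α) - 1)) := by
  intro p hp
  have h := norm_hol_vary_sub_one_le_curl hW hX hXα ht p.1 p.2.1.1 p.2.1.2
  have h1 : ‖((hol W p.1 (plaqWord p.2.1.1 p.2.1.2) : (Matrix n n ℂ)ˣ) : Matrix n n ℂ) - 1‖ ≤ a := ha p hp
  have h2 : ‖curlAt W X p.1 p.2.1.1 p.2.1.2‖ ≤ γ := hγ p hp
  have h3 : t * (‖curlAt W X p.1 p.2.1.1 p.2.1.2‖ + 24 * α * (Real.exp (t * α) - 1))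
      ≤ t * (γ + 24 * α * (Real.exp (t * α) - 1)) :=
    mul_le_mul_of_nonneg_left (by linarith) ht
  show ‖((hol (vary W X t) p.1 (plaqWord p.2.1.1 p.2.1.2) : (Matrix n n ℂ)ˣ) : Matrix n n ℂ) - 1‖ ≤ _
  linarith

end

end Summit.QuantumFields.BalabanUV.T4Continuum.NE3EnergySmallFieldCurl
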